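import Literature.AlgebraicGeometry.HodgeTheory.SupportedClassesGysinSpan
import Literature.AlgebraicGeometry.HodgeTheory.AlgebraicClassesCup
import Summits.HodgeConjecture.HodgeConjecture.Theorems.PadicSemiregularLiftHodgeBeyondAnchorsDiagonalPullback
import HarnessLib

/-!
# Cup product with a divisor class raises the coniveau by one: `Nˡ H²ˡ ∪ N¹ H² ⊆ Nˡ⁺¹ H²ˡ⁺²`

Route `BoundaryReadout` / `QbarEnvelope` of `HodgeConjecture`, crux `PullbackAlgebraic`
(stmt-HodgeConjecture-1071), line `normal_cone`, stub `stub_cupDivisor`. On a smooth projective complex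
variety `X`, for `a ∈ Nˡ H²ˡ(X(ℂ); ℂ) = algebraicClasses X l` and a divisor class
`d ∈ N¹ H²(X(ℂ); ℂ) = algebraicClasses X 1`, the cup product `a ∪ d` lies in
`Nˡ⁺¹ H²ˡ⁺²(X(ℂ); ℂ) = algebraicClasses X (l + 1)` (W. Fulton, *Intersection Theory*, §19.2 Cor. 19.2
with §2.3; C. Voisin, *Hodge Theory II*, §9.2.4 Prop. 9.20 for a divisor). No moving lemma is used: the
proof goes through Grothendieck's description of the coniveau filtration by Gysin images (all inputs
are theorems of the tree).

* Deligne span (`supportedClasses_le_iSup_range_complexGysin`, Deligne Hodge III Cor. 8.2.8 +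
  Hironaka): `a` is a finite sum of Gysin images `g_* u`, `g : Y ⟶ X` from smooth projective `Y` of
  dimension `m` with `m + l ≤ n`, `u ∈ Hᵃ⁰(Y(ℂ); ℂ)`;
* graded commutativity (`cupProduct_gradedComm_holds`): `g_* u ∪ d = ± d ∪ g_* u`;
* projection formula (`complexGysin_cup`, Fulton *Young Tableaux* App. B (6)):
  `d ∪ g_* u = g_* (g^* d ∪ u)`;
* Lefschetz `(1,1)` (`HodgeBeyondAnchors.map_mem_algebraicClasses_one`): `g^* d ∈ N¹ H²(Y)`;
* cup product with supports (`cupProduct_mem_supportedClasses_of_inter`): `N¹ Hⁱ ∪ Hʲ ⊆ N¹ Hⁱ⁺ʲ`, so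
  `g^* d ∪ u ∈ N¹`;
* support of Gysin images (`complexGysin_mem_supportedClasses` with
  `gysinMap_restrictCompl_eq_zero_of_field ℂ`): `g_*` maps `N¹ H(Y)` into `Nˡ⁺¹ H(X)` since
  `(l + 1) + m ≤ n + 1`.

## References

* [Fulton1998] W. Fulton, Intersection Theory, 2nd ed. (1998), §2.3 and §19.2 Cor. 19.2.
* [VoisinHodgeII2003] C. Voisin, Hodge Theory and Complex Algebraic Geometry II (2003), §9.2.4 Prop. 9.20.
* [GrothendieckTopology1969] A. Grothendieck, Hodge's general conjecture is false for trivial reasons,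
  Topology 8 (1969), §1 and p. 300.
* [FultonYoungTableaux1997] W. Fulton, Young Tableaux (1997), App. B §B.1 (6).
-/

noncomputable section

-- `Summit.HodgeConjecture.HodgeConjecture.…` is the mandated namespace (single-conjunct summit).
set_option linter.dupNamespace false

namespace Summit.HodgeConjecture.HodgeConjecture.Theorems.PullbackAlgebraicNormalCone

open CategoryTheory AlgebraicGeometry Literature.AlgebraicGeometry Literature.AlgebraicGeometry.Motives
  Literature.AlgebraicGeometry.HodgeTheory Literature.AlgebraicTopology.SingularHomology

namespace CupDivisor

/-- **`Nʳ Hⁱ ∪ Hʲ ⊆ Nʳ Hⁱ⁺ʲ`**: a class supported in codimension `≥ r` cup ANY class is supported in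
codimension `≥ r` (if `a` dies on `(X ∖ Z)(ℂ)` then so does `a ∪ b`, restriction being multiplicative:
the cup product with supports `cupProduct_mem_supportedClasses_of_inter` with the second support a
closed set off which `b` dies, which exists because `N⁰ = ⊤`). [cite: Fulton1998, §19.2 Cor. 19.2] -/
theorem cupProduct_mem_supportedClasses_left {X : SchemeOver ℂ} {i j k : ℕ} (h : i + j = k) {r : ℕ}
    {a : complexBetti X i} (ha : a ∈ supportedClasses X i r) (b : complexBetti X j) :
    cupProduct h a b ∈ supportedClasses X k r := by
  -- `b` dies off some Zariski-closed `W` (`N⁰ Hʲ = Hʲ`)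
  obtain ⟨W, hW, -, hbW⟩ := exists_support_of_mem_supportedClasses
    (show b ∈ supportedClasses X j 0 by rw [supportedClasses_zero]; exact Submodule.mem_top)
  have hle : supportedClasses X i r ≤ (supportedClasses X k r).comap ((cupProduct h).flip b) :=
    supportedClasses_le fun Z hZ hZr a ha ↦ by
      rw [Submodule.mem_comap, LinearMap.flip_apply]
      exact cupProduct_mem_supportedClasses_of_inter hZ hW (fun t ht ↦ hZr t ht.1) h
        (LinearMap.mem_ker.mp ha) hbW
  have hab := hle ha
  rw [Submodule.mem_comap, LinearMap.flip_apply] at hab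
  exact hab

/-- **A Gysin image cup a divisor class is algebraic of the next codimension**: for `g : Y ⟶ X` of
smooth projective varieties (`dim Y = m`, `dim X = n`, `m + l ≤ n`), `u ∈ Hᵃ⁰(Y(ℂ); ℂ)` with
`a₀ + 2n = 2l + 2m` and a divisor class `d ∈ N¹ H²(X)`, `g_* u ∪ d ∈ Nˡ⁺¹ H²ˡ⁺²(X)`:
`g_* u ∪ d = ± d ∪ g_* u = ± g_* (g^* d ∪ u)` (graded commutativity and the projection formula),
`g^* d ∈ N¹ H²(Y)` (Lefschetz `(1,1)`), `g^* d ∪ u ∈ N¹` and `g_* (N¹) ⊆ Nˡ⁺¹`.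
[cite: FultonYoungTableaux1997, Appendix B §B.1 (6)] [cite: VoisinHodgeII2003, §9.2.4 Prop. 9.20] -/
theorem complexGysin_cupProduct_mem_algebraicClasses {μ : OrientationFamily}
    (hμ : μ.HasPoincareDuality) {m n : ℕ} {Y X : SchemeOver ℂ} (hY : IsSmoothProjective m Y)
    (hX : IsSmoothProjective n X) (g : Y ⟶ X) {l a₀ : ℕ} (hml : m + l ≤ n)
    (hab : a₀ + 2 * n = 2 * l + 2 * m) (h : 2 * l + 2 * 1 = 2 * (l + 1)) (u : complexBetti Y a₀)
    {d : complexBetti X (2 * 1)} (hd : d ∈ algebraicClasses X 1) :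
    cupProduct h (complexGysin μ hY hX g hab u) d ∈ algebraicClasses X (l + 1) := by
  -- graded commutativity: `g_* u ∪ d = ± d ∪ g_* u`
  rw [cupProduct_gradedComm_holds ℂ (Motives.ComplexPoints X) h (by omega) _ d]
  refine Submodule.smul_mem _ _ ?_
  -- projection formula: `d ∪ g_* u = g_* (g^* d ∪ u)`
  rw [← complexGysin_cup hμ hY hX g (rfl : 2 * 1 + a₀ = 2 * 1 + a₀)
    (show 2 * 1 + a₀ + 2 * n = 2 * (l + 1) + 2 * m by omega) hab _ d u]
  -- `g^* d ∈ N¹ H²(Y)`, so `g^* d ∪ u ∈ N¹`, and `g_*` maps `N¹(Y)` into `Nˡ⁺¹(X)`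
  exact complexGysin_mem_supportedClasses (gysinMap_restrictCompl_eq_zero_of_field ℂ) μ hμ hY hX g _
    (r := 1) (s := l + 1) (by omega)
    (cupProduct_mem_supportedClasses_left _
      (HodgeBeyondAnchors.map_mem_algebraicClasses_one hX hY g hd) u)

end CupDivisor

/-- **Cup product with a divisor class raises the coniveau by one:
`Nˡ H²ˡ(X) ∪ N¹ H²(X) ⊆ Nˡ⁺¹ H²ˡ⁺²(X)`** on every smooth projective complex variety `X` (Fulton 1998,
§2.3 and Cor. 19.2; Voisin II, §9.2.4 Prop. 9.20 for a divisor — no moving lemma). Write `a = Σ g_* u`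
over morphisms `g : Y ⟶ X` from smooth projective `Y` of dimension `m ≤ n - l` (Deligne span of the
coniveau filtration, `supportedClasses_le_iSup_range_complexGysin`, for the complex orientation family,
which has Poincaré duality); each `g_* u ∪ d` is algebraic of codimension `l + 1`
(`CupDivisor.complexGysin_cupProduct_mem_algebraicClasses`), and `a ↦ a ∪ d` is linear.
[cite: Fulton1998, §19.2 Cor. 19.2] [cite: VoisinHodgeII2003, §9.2.4 Prop. 9.20]
[cite: GrothendieckTopology1969, §1 and p. 300] -/
theorem stub_cupDivisor :
    ∀ ⦃n : ℕ⦄ ⦃X : SchemeOver ℂ⦄, IsSmoothProjective n X → ∀ (l : ℕ) (a : complexBetti X (2 * l))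
      (d : complexBetti X (2 * 1)), a ∈ algebraicClasses X l → d ∈ algebraicClasses X 1 →
      cupProduct (show 2 * l + 2 * 1 = 2 * (l + 1) by omega) a d ∈ algebraicClasses X (l + 1) := by
  intro n X hX l a d ha hd
  -- the complex orientation family, with Poincaré duality
  obtain ⟨μ, hμ⟩ : ∃ μ : OrientationFamily, μ.HasPoincareDuality :=
    ⟨fun _ _ h ↦ Classical.choice (Motives.ComplexPoints.isOrientableOver ℂ h),
      OrientationFamily.hasPoincareDuality _⟩
  -- each Gysin image works, hence their span
  have hle : (⨆ (m : ℕ) (_ : m + l ≤ n) (Y : SchemeOver ℂ) (hY : IsSmoothProjective m Y)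
        (g : Y ⟶ X) (a₀ : ℕ) (hab : a₀ + 2 * n = 2 * l + 2 * m),
        LinearMap.range (complexGysin μ hY hX g hab)) ≤
      (algebraicClasses X (l + 1)).comap
        ((cupProduct (show 2 * l + 2 * 1 = 2 * (l + 1) by omega)).flip d) := by
    refine iSup_le fun m ↦ iSup_le fun hm ↦ iSup_le fun Y ↦ iSup_le fun hY ↦
      iSup_le fun g ↦ iSup_le fun a₀ ↦ iSup_le fun hab ↦ ?_
    rintro _ ⟨u, rfl⟩
    rw [Submodule.mem_comap, LinearMap.flip_apply]
    exact CupDivisor.complexGysin_cupProduct_mem_algebraicClasses hμ hY hX g hm hab _ u hd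
  -- Deligne span: `a` lies in that span
  have hmem := ((supportedClasses_le_iSup_range_complexGysin μ hX (2 * l) l).trans hle) ha
  rw [Submodule.mem_comap, LinearMap.flip_apply] at hmem
  exact hmem

end Summit.HodgeConjecture.HodgeConjecture.Theorems.PullbackAlgebraicNormalCone

end
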